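import Literature.NumberTheory.EllipticCurves.TateCurve.NumberFieldUniformization
import Literature.NumberTheory.EllipticCurves.VariableChangePointsGalois
import Literature.NumberTheory.EllipticCurves.WeierstrassFieldOfModuliProofs
import HarnessLib

/-!
# Tate's `v`-adic uniformisation TWISTED by the quadratic character of `K_v(√γ)/K_v`, at a place of
# multiplicative reduction (Silverman, *Advanced Topics*, Lemma V.5.2 (c), Thm. V.5.3, Cor. V.5.4)
# — the named fact `Silverman1994_thmV53_corV54_tateUniformisation` DISCHARGED

Topic `Literature/NumberTheory/EllipticCurves/TateCurve`, namespace
`Literature.NumberTheory.EllipticCurves.TateCurve` (abc-iut cell, seat abc-iut-w5-d205; sequel to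
`NumberFieldUniformization.lean`, which discharged the SPLIT case
`Silverman1994_thmV53_tateUniformisation`, abc-iut-L6-t14). Universe `0` (number fields in `Type`,
the universe of the tree's normed-field instance on `v.adicCompletion K`), exactly as for the
split discharge. Proof-only file (theorems only); the `NontriviallyNormedField` structure on `K_v`
(`GaloisRepresentations.Ultrametric.AdicCompletion.nontriviallyNormedField`, definitionally the
registered `NormedField`) is introduced with `letI` inside the proofs that call the Tate-curve
stack, so no instance attribute is set.

Assembly, following Silverman *ATAEC* §V.5 (PDF pp. 406–410). Let `W/K` be an elliptic curve
over a number field with multiplicative reduction at `v`, `K_v` the completion, `K̄_v` its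
algebraic closure, `Γ = Gal(K̄_v/K_v)`, `E_q` the Tate curve.
1. *AEC* VII.5.1 (b): the chosen local minimal model has `|j| > 1`
   (`one_lt_norm_j_of_hasMultiplicativeReduction_holds`), so `j ≠ 0, 1728` and `c₄ c₆ ≠ 0`.
2. V.5.3 (a): there are `q ∈ K_v`, `0 < |q| < 1`, `j(E_q) = j(W)`, and an isomorphism
   `C : W ⊗ K̄_v ⥲ E_q ⊗ K̄_v` (`isomorphic_tateCurve_of_one_lt_norm_j_holds`; `C` a change of
   variables with coefficients in `K̄_v`).
3. Lemma V.5.2 (a),(c) — the sign: `γ(E_q) = u_C² γ(W)` (`c₄' = u⁻⁴c₄`, `c₆' = u⁻⁶c₆`) with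
   `γ(E_q/K_v) = s²`, `s ∈ K_v` (`isSquare_gamma_tateCurve`) and `t² = γ(W)`, `t ∈ K̄_v`; hence
   `u_C t = ± s ∈ K_v` and `σ(u_C) = u_C ⟺ σ t = t` (`map_u_eq_iff_map_eq`). By abc-iut-L2-t5's
   `VariableChangePointsGalois` (Silverman *AEC* III.10.1: `Aut(E_q) = {±1}` as `c₄ c₆ ≠ 0`) the
   conjugate `C^σ` is `C` or `ι ∘ C` (`ι` the negation), according as `σ(u_C) = ± u_C`, and on
   points `σ(C(P)) = ± C(σ P)` — Lemma V.5.2 (c) with `χ(σ) = +1` iff `σ t = t`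
   (`smul_eq_sign_smul`).
4. V.3.1 (c),(d): Tate's `φ : K̄_v^* → E_q(K̄_v)` (`uniformization_holds`, abc-iut-L2-t5). Then
   `Ψ = C⁻¹ ∘ φ` is surjective with kernel `q^ℤ` and `σ • Ψ(u) = χ(σ) Ψ(σ u)`.
5. Cor. V.5.4: a `Γ`-fixed point `P` has `Q = C(P)` fixed by `Gal(K̄_v/K_v(t))`, so `Q = φ(u)` with
   `u ∈ K_v(t)` (clause (d) of `uniformization` with `L = K_v(t)`), and for `σ t ≠ t`,
   `φ(σu) = σQ = -Q = -φ(u)`, i.e. `u σ(u) ∈ ker φ = q^ℤ`.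

## References
* [SilvermanATAEC1994] J. H. Silverman, *Advanced Topics in the Arithmetic of Elliptic Curves*,
  GTM 151, Springer 1994, Lemma V.5.2, Thm. V.5.3, Cor. V.5.4 (PDF pp. 406–410), Thm. V.3.1
  (c),(d) (PDF p. 395).
* [SilvermanAEC2009] J. H. Silverman, *The Arithmetic of Elliptic Curves*, 2nd ed., VII.5.1 (b),
  III.10.1.
-/

noncomputable section

open scoped Classical
open NumberField IsDedekindDomain WeierstrassCurve Field

namespace Literature.NumberTheory.EllipticCurves.TateCurve

open SteinWuthrich2013 Literature.NumberTheory.EllipticCurves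

section Local

variable {K : Type} [Field K] [NumberField K] (W : WeierstrassCurve K) [W.IsElliptic]
  (v : HeightOneSpectrum (𝓞 K))

/-! ### Step 1: `|j|_v > 1` and `c₄ c₆ ≠ 0` at a place of multiplicative reduction -/

/-- **Silverman *AEC* VII.5.1 (b) at a finite place of a number field**: if `W` has multiplicative
reduction at `v` then `|j(W)|_v > 1` (the chosen local minimal model is a minimal equation with
multiplicative reduction; `j` is a change-of-variables invariant).
[cite: SilvermanAEC2009, Prop. VII.5.1 (b)] -/
theorem one_lt_norm_j_baseChange_of_hasMultiplicativeReductionAt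
    (h : W.HasMultiplicativeReductionAt v) :
    1 < ‖(W.baseChange (v.adicCompletion K)).j‖ := by
  letI := GaloisRepresentations.Ultrametric.AdicCompletion.nontriviallyNormedField K v
  haveI := charZero_adicCompletion' K v
  obtain ⟨C₀, hC₀⟩ : ∃ C : VariableChange (v.adicCompletion K),
      (C • W.baseChange (v.adicCompletion K)).HasMultiplicativeReduction
        (v.adicCompletionIntegers K) := ⟨_, h⟩
  rw [← variableChange_j (W.baseChange (v.adicCompletion K)) C₀]
  exact one_lt_norm_j_of_hasMultiplicativeReduction_holds (v.adicCompletionIntegers K)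
    (norm_le_one_iff_mem_range_adicCompletionIntegers K v) _ hC₀

/-- At a place of multiplicative reduction `c₄(W) ≠ 0` and `c₆(W) ≠ 0` (since `|j|_v > 1` gives
`j ≠ 0, 1728`), so the invariant `γ(W/K) = -c₄/c₆` of Lemma V.5.2 is a nonzero element of `K`.
[cite: SilvermanATAEC1994, Lemma V.5.2 (PDF p. 406)] -/
theorem c₄_ne_zero_and_c₆_ne_zero_of_hasMultiplicativeReductionAt
    (h : W.HasMultiplicativeReductionAt v) : W.c₄ ≠ 0 ∧ W.c₆ ≠ 0 := by
  letI := GaloisRepresentations.Ultrametric.AdicCompletion.nontriviallyNormedField K v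
  haveI := charZero_adicCompletion' K v
  have hj := one_lt_norm_j_baseChange_of_hasMultiplicativeReductionAt W v h
  obtain ⟨h0, h1728⟩ := j_ne_zero_and_ne_1728_of_one_lt_norm hj
  have hjv : (W.baseChange (v.adicCompletion K)).j = algebraMap K (v.adicCompletion K) W.j :=
    W.map_j _
  rw [hjv] at h0 h1728
  have h0' : W.j ≠ 0 := fun e ↦ h0 (by rw [e, map_zero])
  have h1728' : W.j ≠ 1728 := fun e ↦ h1728 (by rw [e, map_ofNat])
  exact ⟨fun e ↦ h0' (W.j_eq_zero e), WeierstrassCurve.c₆_ne_zero_of_j_ne W h1728'⟩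

/-- The Tate curve `E_q` with `j(E_q) = j(W ⊗ K_v)` and `|j|_v > 1` has `c₄(E_q) ≠ 0` and
`c₆(E_q) ≠ 0` (`j ≠ 0, 1728`), i.e. `γ(E_q/K_v)` is defined — the standing hypothesis
"`j(E) ≠ 0, 1728`" of Lemma V.5.2 for `E' = E_q`. [cite: SilvermanATAEC1994, Lemma V.5.2 (PDF p. 406)] -/
theorem tateCurve_c₄_ne_zero_and_c₆_ne_zero {q : v.adicCompletion K} (hq0 : q ≠ 0) (hq : ‖q‖ < 1)
    (hqj : tateJ q = (W.baseChange (v.adicCompletion K)).j)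
    (hj : 1 < ‖(W.baseChange (v.adicCompletion K)).j‖) :
    (tateCurve q).c₄ ≠ 0 ∧ (tateCurve q).c₆ ≠ 0 := by
  letI := GaloisRepresentations.Ultrametric.AdicCompletion.nontriviallyNormedField K v
  haveI := charZero_adicCompletion' K v
  haveI := tateCurve_isElliptic hq0 hq
  have hjE : (tateCurve q).j = (W.baseChange (v.adicCompletion K)).j := by rw [tateCurve_j hq, hqj]
  rw [← hjE] at hj
  obtain ⟨h0, h1728⟩ := j_ne_zero_and_ne_1728_of_one_lt_norm hj
  exact ⟨fun e ↦ h0 ((tateCurve q).j_eq_zero e), WeierstrassCurve.c₆_ne_zero_of_j_ne _ h1728⟩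

/-! ### Step 3: Lemma V.5.2 (a),(c) — the sign of `σ` on `√γ` is the sign of `σ` on `u_C` -/

omit [W.IsElliptic] in
/-- **Lemma V.5.2 (a) read through `C : W ⊗ K̄_v ⥲ E_q ⊗ K̄_v`.** With `c₄(W) c₆(W) ≠ 0`,
`‖q‖ < 1`, and `t ∈ K̄_v`, `t² = γ(W) = -c₄/c₆`: since `c₄(E_q) = u⁻⁴ c₄(W)`,
`c₆(E_q) = u⁻⁶ c₆(W)` (`u = u_C`) one has `γ(E_q) = u² γ(W)`, and `γ(E_q/K_v) = s²` with
`s ∈ K_v` (`isSquare_gamma_tateCurve`); so `(u t)² = s²`, `u t = ± s` is FIXED by every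
`σ ∈ Γ_{K_v}`, whence `σ(u) = u ⟺ σ t = t` (the other possibility being `σ t = -t`, `σ u = -u`).
[cite: SilvermanATAEC1994, Lemma V.5.2 (a),(c) (PDF pp. 406–407)] -/
theorem map_u_eq_iff_map_eq (hc₄ : W.c₄ ≠ 0) (hc₆ : W.c₆ ≠ 0) {q : v.adicCompletion K}
    (hq : ‖q‖ < 1) (C : VariableChange (AlgebraicClosure (v.adicCompletion K)))
    (hC : C • (W.baseChange (v.adicCompletion K)).baseChange (AlgebraicClosure (v.adicCompletion K))
      = (tateCurve q).baseChange (AlgebraicClosure (v.adicCompletion K)))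
    {t : AlgebraicClosure (v.adicCompletion K)}
    (ht : t ^ 2 = algebraMap (v.adicCompletion K) (AlgebraicClosure (v.adicCompletion K))
      (algebraMap K (v.adicCompletion K) (-(W.c₄ / W.c₆))))
    (σ : absoluteGaloisGroup (v.adicCompletion K)) :
    absoluteGaloisGroup.toAlgEquiv _ σ (C.u : AlgebraicClosure (v.adicCompletion K)) = C.u ↔
      absoluteGaloisGroup.toAlgEquiv _ σ t = t := by
  letI := GaloisRepresentations.Ultrametric.AdicCompletion.nontriviallyNormedField K v
  haveI := charZero_adicCompletion' K v
  haveI : CharZero (AlgebraicClosure (v.adicCompletion K)) :=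
    charZero_of_injective_algebraMap
      (algebraMap (v.adicCompletion K) (AlgebraicClosure (v.adicCompletion K))).injective
  have hu0 : (C.u : AlgebraicClosure (v.adicCompletion K)) ≠ 0 := C.u.ne_zero
  -- `t² = -c₄/c₆` read in `K̄_v`, and `t ≠ 0`
  simp only [map_neg, map_div₀] at ht
  have hc₆b : algebraMap (v.adicCompletion K) (AlgebraicClosure (v.adicCompletion K))
      (algebraMap K (v.adicCompletion K) W.c₆) ≠ 0 := by
    rw [Ne, map_eq_zero, map_eq_zero]; exact hc₆
  have ht0 : t ≠ 0 := by
    intro h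
    rw [h, zero_pow two_ne_zero, eq_comm, neg_eq_zero, div_eq_zero_iff, map_eq_zero, map_eq_zero]
      at ht
    exact ht.elim hc₄ hc₆b
  -- `γ(E_q/K_v) = s²`, `s ∈ K_v`
  obtain ⟨s, hs⟩ := isSquare_gamma_tateCurve hq (by norm_num : (12 : v.adicCompletion K) ≠ 0)
  -- `c₄(E_q) = u⁻⁴ c₄(W)`, `c₆(E_q) = u⁻⁶ c₆(W)` in `K̄_v`
  have hWc₄ : ((W.baseChange (v.adicCompletion K)).baseChange
      (AlgebraicClosure (v.adicCompletion K))).c₄ =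
      algebraMap (v.adicCompletion K) (AlgebraicClosure (v.adicCompletion K))
        (algebraMap K (v.adicCompletion K) W.c₄) := by
    rw [show ((W.baseChange (v.adicCompletion K)).baseChange
        (AlgebraicClosure (v.adicCompletion K))).c₄ = algebraMap (v.adicCompletion K)
        (AlgebraicClosure (v.adicCompletion K)) (W.baseChange (v.adicCompletion K)).c₄ from
      (W.baseChange (v.adicCompletion K)).map_c₄ _,
      show (W.baseChange (v.adicCompletion K)).c₄ = algebraMap K (v.adicCompletion K) W.c₄ from
      W.map_c₄ _]
  have hWc₆ : ((W.baseChange (v.adicCompletion K)).baseChange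
      (AlgebraicClosure (v.adicCompletion K))).c₆ =
      algebraMap (v.adicCompletion K) (AlgebraicClosure (v.adicCompletion K))
        (algebraMap K (v.adicCompletion K) W.c₆) := by
    rw [show ((W.baseChange (v.adicCompletion K)).baseChange
        (AlgebraicClosure (v.adicCompletion K))).c₆ = algebraMap (v.adicCompletion K)
        (AlgebraicClosure (v.adicCompletion K)) (W.baseChange (v.adicCompletion K)).c₆ from
      (W.baseChange (v.adicCompletion K)).map_c₆ _,
      show (W.baseChange (v.adicCompletion K)).c₆ = algebraMap K (v.adicCompletion K) W.c₆ from
      W.map_c₆ _]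
  have hEc₄ : ((tateCurve q).baseChange (AlgebraicClosure (v.adicCompletion K))).c₄ =
      algebraMap (v.adicCompletion K) (AlgebraicClosure (v.adicCompletion K)) (tateCurve q).c₄ :=
    (tateCurve q).map_c₄ _
  have hEc₆ : ((tateCurve q).baseChange (AlgebraicClosure (v.adicCompletion K))).c₆ =
      algebraMap (v.adicCompletion K) (AlgebraicClosure (v.adicCompletion K)) (tateCurve q).c₆ :=
    (tateCurve q).map_c₆ _
  have h4 := congrArg WeierstrassCurve.c₄ hC
  have h6 := congrArg WeierstrassCurve.c₆ hC
  rw [variableChange_c₄, hWc₄, hEc₄] at h4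
  rw [variableChange_c₆, hWc₆, hEc₆] at h6
  -- `s² = γ(E_q) = u² γ(W) = u² t²`
  have hγrel : (algebraMap (v.adicCompletion K) (AlgebraicClosure (v.adicCompletion K)) s) ^ 2 =
      (C.u : AlgebraicClosure (v.adicCompletion K)) ^ 2 * t ^ 2 := by
    have hs' : algebraMap (v.adicCompletion K) (AlgebraicClosure (v.adicCompletion K))
        (-((tateCurve q).c₄ / (tateCurve q).c₆)) =
        (algebraMap (v.adicCompletion K) (AlgebraicClosure (v.adicCompletion K)) s) ^ 2 := by
      rw [hs, map_mul, sq]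
    have hγE : algebraMap (v.adicCompletion K) (AlgebraicClosure (v.adicCompletion K))
        (-((tateCurve q).c₄ / (tateCurve q).c₆)) =
        -((((C.u⁻¹ : (AlgebraicClosure (v.adicCompletion K))ˣ) :
            AlgebraicClosure (v.adicCompletion K)) ^ 4 *
            algebraMap (v.adicCompletion K) (AlgebraicClosure (v.adicCompletion K))
              (algebraMap K (v.adicCompletion K) W.c₄)) /
          (((C.u⁻¹ : (AlgebraicClosure (v.adicCompletion K))ˣ) :
            AlgebraicClosure (v.adicCompletion K)) ^ 6 *
            algebraMap (v.adicCompletion K) (AlgebraicClosure (v.adicCompletion K))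
              (algebraMap K (v.adicCompletion K) W.c₆))) := by
      rw [map_neg, map_div₀, ← h4, ← h6]
    rw [← hs', hγE, ht, Units.val_inv_eq_inv_val]
    field_simp
  -- hence `u t = ± s` is fixed by `σ`
  have htu : (C.u : AlgebraicClosure (v.adicCompletion K)) * t =
        algebraMap (v.adicCompletion K) (AlgebraicClosure (v.adicCompletion K)) s ∨
      (C.u : AlgebraicClosure (v.adicCompletion K)) * t =
        -algebraMap (v.adicCompletion K) (AlgebraicClosure (v.adicCompletion K)) s :=
    sq_eq_sq_iff_eq_or_eq_neg.mp (by rw [mul_pow, hγrel])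
  have hσut : absoluteGaloisGroup.toAlgEquiv _ σ
      ((C.u : AlgebraicClosure (v.adicCompletion K)) * t) =
      (C.u : AlgebraicClosure (v.adicCompletion K)) * t := by
    rcases htu with h | h <;> simp only [h, map_neg, AlgEquiv.commutes]
  rw [map_mul] at hσut
  -- `σ t = ± t`
  have hfixt : absoluteGaloisGroup.toAlgEquiv _ σ t = t ∨
      absoluteGaloisGroup.toAlgEquiv _ σ t = -t := by
    apply sq_eq_sq_iff_eq_or_eq_neg.mp
    rw [← map_pow, ht, map_neg, map_div₀, AlgEquiv.commutes, AlgEquiv.commutes]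
  constructor
  · -- `σ u = u`: if `σ t ≠ t` then `σ t = -t` and `u (-t) = u t`, so `u t = 0`
    intro hσu
    by_contra hne
    rw [hσu, hfixt.resolve_left hne, mul_neg] at hσut
    have h2 : (2 : AlgebraicClosure (v.adicCompletion K)) * ((C.u : _) * t) = 0 := by
      linear_combination -hσut
    exact mul_ne_zero hu0 ht0 ((mul_eq_zero.mp h2).resolve_left two_ne_zero)
  · -- `σ t = t`: then `σ(u) t = u t`
    intro hσt
    rw [hσt] at hσut
    exact mul_right_cancel₀ ht0 hσut

/-! ### Step 3 (continued): Lemma V.5.2 (c) on points — `σ(C(P)) = χ(σ) C(σ P)` -/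

omit [W.IsElliptic] in
/-- **Lemma V.5.2 (c), the twisted equivariance of `C : E(K̄_v) ⥲ E_q(K̄_v)`.** For the additive
isomorphism `e` of point groups induced by `C` (`e = congrEquiv hC ∘ pointEquiv C`, on the local
points `E(K̄_v) = localPoints W K_v` read on `(W ⊗ K_v) ⊗ K̄_v`), and `σ ∈ Γ_{K_v}`:
`σ(e(P)) = χ(σ) · e(σ P)` with `χ(σ) = 1` if `σ t = t` and `χ(σ) = -1` otherwise (`t² = γ(W)`).
The conjugate `C^σ` is `C` or `ι ∘ C` by abc-iut-L2-t5's `map_eq_self_or_eq_negY_mul`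
(Silverman *AEC* III.10.1), the case being decided by `σ(u_C) = ± u_C`, i.e. (by
`map_u_eq_iff_map_eq`) by the sign of `σ` on `t`.
[cite: SilvermanATAEC1994, Lemma V.5.2 (c) (PDF pp. 406–407)] -/
theorem smul_eq_sign_smul (hc₄ : W.c₄ ≠ 0) (hc₆ : W.c₆ ≠ 0) {q : v.adicCompletion K}
    (hq : ‖q‖ < 1) (hEc₄ : (tateCurve q).c₄ ≠ 0) (hEc₆ : (tateCurve q).c₆ ≠ 0)
    (C : VariableChange (AlgebraicClosure (v.adicCompletion K)))
    (hC : C • (W.baseChange (v.adicCompletion K)).baseChange (AlgebraicClosure (v.adicCompletion K))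
      = (tateCurve q).baseChange (AlgebraicClosure (v.adicCompletion K)))
    {t : AlgebraicClosure (v.adicCompletion K)}
    (ht : t ^ 2 = algebraMap (v.adicCompletion K) (AlgebraicClosure (v.adicCompletion K))
      (algebraMap K (v.adicCompletion K) (-(W.c₄ / W.c₆))))
    (e : localPoints W (v.adicCompletion K) ≃+ geomPoints (tateCurve q))
    (he : ∀ P, e P = Affine.Point.congrEquiv hC (VariableChange.pointEquiv _ C
      (Affine.Point.congrEquiv (W.baseChange_baseChange_adicCompletion v).symm P)))
    (σ : absoluteGaloisGroup (v.adicCompletion K)) (P : localPoints W (v.adicCompletion K)) :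
    σ • e P =
      (if absoluteGaloisGroup.toAlgEquiv _ σ t = t then (1 : ℤ) else -1) • e (σ • P) := by
  haveI := charZero_adicCompletion' K v
  haveI : CharZero (AlgebraicClosure (v.adicCompletion K)) :=
    charZero_of_injective_algebraMap
      (algebraMap (v.adicCompletion K) (AlgebraicClosure (v.adicCompletion K))).injective
  have h2 : (2 : v.adicCompletion K) ≠ 0 := by norm_num
  have h3 : (3 : v.adicCompletion K) ≠ 0 := by norm_num
  -- `C^σ ∈ {C, ι ∘ C}`
  have hdich := VariableChange.map_eq_self_or_eq_negY_mul (W.baseChange (v.adicCompletion K))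
    (tateCurve q) C hC (absoluteGaloisGroup.toAlgEquiv _ σ : AlgebraicClosure (v.adicCompletion K)
      →ₐ[v.adicCompletion K] AlgebraicClosure (v.adicCompletion K)) h2 h3 hEc₄ hEc₆
  have hiff := map_u_eq_iff_map_eq W v hc₄ hc₆ hq C hC ht σ
  rw [he, he, WeierstrassCurve.congrEquiv_smul W v σ P]
  change Affine.Point.map (absoluteGaloisGroup.toAlgEquiv _ σ : AlgebraicClosure (v.adicCompletion K)
      →ₐ[v.adicCompletion K] AlgebraicClosure (v.adicCompletion K))
    (Affine.Point.congrEquiv hC (VariableChange.pointEquiv _ C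
      (Affine.Point.congrEquiv (W.baseChange_baseChange_adicCompletion v).symm P))) = _
  split_ifs with hσt
  · rw [one_zsmul]
    exact VariableChange.map_congrEquiv_pointEquiv_of_map_eq _ _ C hC _
      (VariableChange.map_eq_self_of_map_u_eq _ C _ hdich (by norm_num) (hiff.mpr hσt)) _
  · rw [neg_one_zsmul]
    exact VariableChange.map_congrEquiv_pointEquiv_of_map_eq_negY_mul _ _ C hC _
      (VariableChange.map_eq_negY_mul_of_map_u_ne _ C _ hdich (fun h ↦ hσt (hiff.mp h))) _

/-! ### The assembly -/

/-- **Silverman *ATAEC* Lemma V.5.2 (c) + Thm. V.5.3 + Cor. V.5.4 — the named fact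
`Silverman1994_thmV53_corV54_tateUniformisation` DISCHARGED** (universe `0`): for an elliptic
curve `W` over a number field `K` with multiplicative reduction (split or non-split) at a finite
place `v`, there are `q ∈ K_v` (`q ≠ 0`, `v(q) < 1`), a square root `t ∈ K̄_v` of
`γ(W/K) = -c₄/c₆`, and a surjective homomorphism `Ψ : K̄_v^* → E(K̄_v)` with kernel `q^ℤ`,
TWISTED-equivariant (`σ • Ψ(u) = χ(σ) Ψ(σu)`, `χ(σ) = 1` iff `σ t = t`), whose `Γ_{K_v}`-fixed
points are the `Ψ(u)` with `u ∈ K_v(t)` and `u σ(u) ∈ q^ℤ` for `σ t ≠ t`.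
[cite: SilvermanATAEC1994, Lemma V.5.2 (c), Thm. V.5.3, Cor. V.5.4 (PDF pp. 406–410)] -/
theorem Silverman1994_thmV53_corV54_tateUniformisation_holds :
    Literature.NumberTheory.EllipticCurves.Silverman1994_thmV53_corV54_tateUniformisation.{0} := by
  intro K _ _ W _ v hmult
  letI := GaloisRepresentations.Ultrametric.AdicCompletion.nontriviallyNormedField K v
  haveI := charZero_adicCompletion' K v
  -- Step 1: `|j|_v > 1`, `c₄ c₆ ≠ 0`
  have hj := one_lt_norm_j_baseChange_of_hasMultiplicativeReductionAt W v hmult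
  obtain ⟨hc₄, hc₆⟩ := c₄_ne_zero_and_c₆_ne_zero_of_hasMultiplicativeReductionAt W v hmult
  -- Step 2: the Tate parameter and an isomorphism `C` over `K̄_v` (V.5.3 (a))
  obtain ⟨q, hq0, hq, hqj, C, hC⟩ :=
    isomorphic_tateCurve_of_one_lt_norm_j_holds (W.baseChange (v.adicCompletion K)) hj
  obtain ⟨hEc₄, hEc₆⟩ := tateCurve_c₄_ne_zero_and_c₆_ne_zero W v hq0 hq hqj hj
  -- the square root `t` of `γ(W)`
  obtain ⟨t, ht⟩ := IsAlgClosed.exists_pow_nat_eq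
    (algebraMap (v.adicCompletion K) (AlgebraicClosure (v.adicCompletion K))
      (algebraMap K (v.adicCompletion K) (-(W.c₄ / W.c₆)))) two_pos
  have ht0 : t ≠ 0 := by
    intro h
    have ht' := ht
    rw [h, zero_pow two_ne_zero, eq_comm, map_eq_zero, map_eq_zero, neg_eq_zero,
      div_eq_zero_iff] at ht'
    exact ht'.elim hc₄ hc₆
  -- Step 4: Tate's `φ` (V.3.1 (c),(d)) and the isomorphism of point groups `e = C`
  obtain ⟨φ, hsurj, hker, hequiv, hrat⟩ := uniformization_holds q hq0 hq
  obtain ⟨e, he⟩ : ∃ e : localPoints W (v.adicCompletion K) ≃+ geomPoints (tateCurve q),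
      ∀ P, e P = Affine.Point.congrEquiv hC (VariableChange.pointEquiv _ C
        (Affine.Point.congrEquiv (W.baseChange_baseChange_adicCompletion v).symm P)) :=
    ⟨(Affine.Point.congrEquiv (W.baseChange_baseChange_adicCompletion v).symm).trans
      ((VariableChange.pointEquiv ((W.baseChange (v.adicCompletion K)).baseChange
        (AlgebraicClosure (v.adicCompletion K))) C).trans (Affine.Point.congrEquiv hC)),
      fun _ ↦ rfl⟩
  have hsign := smul_eq_sign_smul W v hc₄ hc₆ hq hEc₄ hEc₆ C hC ht e he
  -- `Ψ = C⁻¹ ∘ φ`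
  refine ⟨q, t, e.symm.toAddMonoidHom.comp φ, hq0, ?_, ht0, ht, ?_, ?_, ?_, ?_⟩
  · exact (Valued.toNormedField.norm_lt_one_iff).mp hq
  · exact e.symm.surjective.comp hsurj
  · intro u
    rw [← hker u]
    change e.symm (φ (Additive.ofMul u)) = 0 ↔ _
    rw [AddEquiv.map_eq_zero_iff]
  · -- twisted equivariance: `σ Ψ(u) = χ(σ) Ψ(σ u)`
    intro σ u
    change σ • e.symm (φ (Additive.ofMul u)) = _ • e.symm (φ _)
    rw [← hequiv σ u]
    have h1 := hsign σ (e.symm (φ (Additive.ofMul u)))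
    rw [AddEquiv.apply_symm_apply] at h1
    apply e.injective
    rw [map_zsmul, AddEquiv.apply_symm_apply, h1, smul_smul]
    split_ifs <;> simp
  · -- Cor. V.5.4: the `Γ_{K_v}`-fixed points
    intro P hP
    -- `Q = C(P)` is fixed by `Gal(K̄_v / K_v(t))`, hence `Q = φ(u)` with `u ∈ K_v(t)`
    have hP' : ∀ σ : absoluteGaloisGroup (v.adicCompletion K),
        absoluteGaloisGroup.toAlgEquiv (v.adicCompletion K) σ ∈
          (IntermediateField.adjoin (v.adicCompletion K)
            ({t} : Set (AlgebraicClosure (v.adicCompletion K)))).fixingSubgroup →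
          σ • e P = e P := by
      intro σ hσ
      have hσt : absoluteGaloisGroup.toAlgEquiv _ σ t = t :=
        (IntermediateField.mem_fixingSubgroup_iff _ _).mp hσ t
          (IntermediateField.mem_adjoin_simple_self _ t)
      rw [hsign, if_pos hσt, one_zsmul, hP σ]
    obtain ⟨u, hu, hφ⟩ := hrat _ (e P) hP'
    refine ⟨u, ?_, ?_, ?_⟩
    · -- `u ∈ K_v(t)` is fixed by every `σ` fixing `t`
      intro σ hσt
      have hle : IntermediateField.adjoin (v.adicCompletion K)
          ({t} : Set (AlgebraicClosure (v.adicCompletion K))) ≤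
          IntermediateField.fixedField (MulAction.stabilizer
            (AlgebraicClosure (v.adicCompletion K) ≃ₐ[v.adicCompletion K]
              AlgebraicClosure (v.adicCompletion K)) t) := by
        rw [IntermediateField.adjoin_simple_le_iff, IntermediateField.mem_fixedField_iff]
        intro f hf
        exact MulAction.mem_stabilizer_iff.mp hf
      have hu' := (IntermediateField.mem_fixedField_iff _ _).mp (hle hu)
        (absoluteGaloisGroup.toAlgEquiv _ σ) (MulAction.mem_stabilizer_iff.mpr hσt)
      exact Units.ext (by rw [Units.coe_map, MonoidHom.coe_coe]; exact hu')
    · -- for `σ t ≠ t`: `φ(σ u) = σ Q = -Q = -φ(u)`, so `u σ(u) ∈ ker φ = q^ℤ`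
      intro σ hσt
      have h1 := hsign σ P
      rw [hP σ, if_neg hσt, neg_one_zsmul, ← hφ, hequiv σ u] at h1
      have h0 : φ (Additive.ofMul (u * Units.map (absoluteGaloisGroup.toAlgEquiv _ σ :
          AlgebraicClosure (v.adicCompletion K) →* AlgebraicClosure (v.adicCompletion K)) u)) =
          0 := by
        rw [ofMul_mul, map_add, h1, add_neg_cancel]
      exact (hker _).mp h0
    · change e.symm (φ (Additive.ofMul u)) = P
      rw [hφ, AddEquiv.symm_apply_apply]

end Local

end Literature.NumberTheory.EllipticCurves.TateCurve

end
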